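import Literature.NumberTheory.EllipticCurves.FineSelmerTrivialisingRestrictionProofs
import Literature.NumberTheory.EllipticCurves.FineSelmerCongruentCurvesNumberFieldProofs
import Literature.NumberTheory.EllipticCurves.FineSelmerClassGroupCriterion
import Literature.NumberTheory.EllipticCurves.GreenbergVatsal2000.UnramifiedOutsideFinite
import Literature.NumberTheory.EllipticCurves.H1TrivialAction
import Literature.NumberTheory.EllipticCurves.DivisionField
import Literature.NumberTheory.EllipticCurves.DivisionFieldReducibleBorelKernel
import Literature.NumberTheory.EllipticCurves.IwasawaCyclotomicProofs
import Literature.NumberTheory.EllipticCurves.ZpExtensionRestrictCyclotomic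
import Literature.NumberTheory.GaloisRepresentations.AbsIntegersEquiv
import Literature.NumberTheory.GaloisRepresentations.ArtinRestriction
import Literature.NumberTheory.IwasawaTheory.ClassicalMuVanishesUnramifiedClasses
import HarnessLib

/-!
# `Sel₀(K_∞, M)` is finite when the classical `μ` vanishes for the trivialising field `K(M)` —
# Coates–Sujatha 2005 Thm. 3.4 reduced to the character form of Iwasawa's `μ = 0` (proved; no
# definition, no named fact, no `sorry`)

`Proofs` file (theorems only) in topic `NumberTheory/EllipticCurves` (namespace
`Literature.NumberTheory.EllipticCurves.FineSelmerFiniteOfUnramifiedClasses`), written by the prover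
seat `bsd-potss-rkm` g33 (cell `bsd-potss`; item stmt-BirchSwinnertonDyer-19196 `ReducibleKatoMember`,
`--supports`; closes nothing; neither Conjecture A nor BSD is proved for any curve here).

## What is proved

Let `K` be a number field, `p` a prime, `κ` a `ℤ_p`-extension of `K` (`H = Gal(K̄/K_∞)`), `M` a
finite discrete `Γ_K`-module with continuous action, `N = fixingSubgroupOfModule K M = Gal(K̄/K(M))`.
The tree already has (k8t-c4 g21, `FineSelmerTrivialisingRestriction.finite_fineSelmerInfty_of_finite_unramifiedHoms`):
`Sel₀(K_∞, M)` is finite as soon as the set `Hom(N ∩ H, M; ∅)` of everywhere-unramified continuous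
homomorphisms on `Gal(K̄/K(M)·K_∞)` is finite. This file supplies that finiteness from the CLASSICAL
`μ = 0` of the trivialising field, in the form the tree names
(`IwasawaTheory.classicalMuVanishes_finite_unramifiedClasses`, Lang GTM 121 Ch. 5 §§1–4 ∘ class
field theory: growth-form `μ = 0` ⇒ finitely many everywhere-unramified classes of `Gal(F̄/F_∞)` with
values in a trivial `p`-primary module):

* §1 `finite_unramifiedHoms_map_of_finite_unramifiedClasses` — the DIALECT BRIDGE. For a finite
  extension `F/K` (an abstract number field with `Algebra K F`; restriction `res : Γ_F → Γ_K`,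
  `absGaloisRestrict`), a `ℤ_p`-extension `κ_F` of `F` and a trivial `Γ_F`-module structure on `M`:
  if the classes `c ∈ H¹(ker κ_F, M)` all of whose `Γ_F`-conjugates are unramified at every finite place
  of `F` (the set of the named fact, in the `conjH1`/`unramifiedKer` idiom of `GreenbergVatsal2000`)
  form a finite set, then `Hom(res(ker κ_F), M; ∅)` (the `unramifiedHoms` idiom of `H1UnramifiedFinite`:
  continuous homomorphisms killing `I_𝔓 ∩ res(ker κ_F)` for EVERY prime `𝔓` of `\bar ℤ_K`) is finite.
  Transport of inertia: `I_w(F) = I_{𝔓₀(w)}` (Neukirch II (9.6),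
  `inertia_adicCompletionPrime_eq_map_absInertia`), `σ⁻¹ I_𝔓 σ = I_{σ⁻¹𝔓}`, and
  `res(I_𝔔) ≤ I_{ι⁻¹𝔔}` (`AbsIntegersEquiv.absGaloisRestrict_mem_inertia_comap`).
* §2 `kerSubgroup_eq_comap_of_isCyclotomic` — for `κ`, `κ_F` both CYCLOTOMIC, `ker κ_F = res⁻¹(ker κ)`
  with NO degree hypothesis (`F·K_∞^{cyc} = F_∞^{cyc}`; the tree's `…_of_not_dvd_finrank` assumed
  `p ∤ [F:K]`); `range_absGaloisRestrict_eq_fixingSubgroup` — `res(Γ_E) = Gal(K̄/E)` for a NORMAL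
  intermediate field `E ⊆ K̄`; `map_kerSubgroup_eq_inf` — then `res(ker κ_F) = N ⊓ H`.
* §3 `finite_fineSelmerInfty_of_classicalMuVanishes` — assembly: `classicalMuVanishes_finite_unramifiedClasses`
  → (`p` odd, `#M = p^k`, `res(Γ_F) = N`, `ker κ_F = res⁻¹ ker κ`, `ClassicalMuVanishes κ_F`) →
  `Sel₀(K_∞, M)` finite.
* §4 the case `M = E[p]`, `F = K(E[p])` (`WeierstrassCurve.divisionField`):
  `fineSelmerDual_moduleFinite_of_classicalMuVanishes_divisionField` — statement (A) of Coates–Sujatha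
  (dual fine Selmer group of `E` over the cyclotomic `ℤ_p`-extension finitely generated over `ℤ_p`, the
  tree's `∃ γ D` spelling, via `LimSujatha2018.fineSelmerDual_moduleFinite_iff_finite_fineSelmerInfty_torsion`)
  for `E` over a NUMBER FIELD `K` at an odd `p`, from `ClassicalMuVanishes` of the cyclotomic
  `ℤ_p`-extension of `K(E[p])`; and **`thm34_of_classicalMuVanishes_finite_unramifiedClasses`**: the named
  fact `CoatesSujatha2005.thm34_fineSelmerDual_moduleFinite_of_classicalMuVanishes_divisionField`
  (Coates–Sujatha 2005 Thm. 3.4 for `E/ℚ`, the cell's `hCS`) FOLLOWS from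
  `classicalMuVanishes_finite_unramifiedClasses`.

Honest framing: nothing here proves `μ = 0` for any field; the elliptic-curve-specific named fact
(Thm. 3.4) is reduced to the classical structure-theoretic one, and no degree / linear-disjointness
hypothesis on `K(E[p]) ∩ K_∞` is needed.

References: [CoatesSujatha2005] J. Coates, R. Sujatha, Math. Ann. 331 (2005), §3, Thm. 3.4 and its
proof, Cor. 3.5; [Lang1990] Ch. 5 §§1–4; [NeukirchANT1999] Ch. I §9, Ch. II §9 (9.6);
[SilvermanAEC2009] X.§4 Lemma 4.3; [Washington1997] §13.1; [LimSujatha2018] §3.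
-/

set_option autoImplicit false

noncomputable section

open scoped Classical Pointwise

namespace Literature.NumberTheory.EllipticCurves.FineSelmerFiniteOfUnramifiedClasses

open NumberField IsDedekindDomain Field
open Literature.NumberTheory.EllipticCurves Literature.NumberTheory.EllipticCurves.GreenbergSelmer
  Literature.NumberTheory.EllipticCurves.GreenbergVatsal2000
  Literature.NumberTheory.EllipticCurves.FineSelmerTrivialisingRestriction
  Literature.NumberTheory.GaloisRepresentations Literature.NumberTheory.IwasawaTheory

/-! ## §1 The dialect bridge: unramified classes of `ker κ_F` ⇒ `Hom(res(ker κ_F), M; ∅)` finite -/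

section Bridge

/-- `σ⁻¹ I_𝔓 σ ≤ I_{σ⁻¹ 𝔓}` for the inertia group of an ideal under a group acting by ring
automorphisms. [cite: NeukirchANT1999, Ch. I §9, remark after (9.5) and Prop. (9.6)] -/
theorem conj_mem_inertia_inv_smul {S : Type*} [CommRing S] {G : Type*} [Group G]
    [MulSemiringAction G S] (𝔓 : Ideal S) {x : G} (hx : x ∈ 𝔓.inertia G) (g : G) :
    g⁻¹ * x * g ∈ (g⁻¹ • 𝔓).inertia G := by
  intro y
  change (g⁻¹ * x * g) • y - y ∈ g⁻¹ • 𝔓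
  rw [Ideal.mem_pointwise_smul_iff_inv_smul_mem, inv_inv, smul_sub, mul_smul, mul_smul,
    smul_inv_smul]
  exact hx (g • y)

variable {K : Type} [Field K] [NumberField K] {F : Type} [Field F] [NumberField F] [Algebra K F]
  [Algebra.IsAlgebraic K F]
variable {p : ℕ} [Fact p.Prime]
variable {M : Type} [AddCommGroup M] [TopologicalSpace M] [DiscreteTopology M]

/-- **The dialect bridge.** Let `F/K` be an (algebraic) extension of number fields,
`res : Γ_F → Γ_K` the restriction, `κ_F` a `ℤ_p`-extension of `F`, and let `Γ_F` act TRIVIALLY on the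
discrete group `M`. If the classes `c ∈ H¹(ker κ_F, M)` all of whose `Γ_F`-conjugates are unramified
at (the chosen place above) every finite place `w` of `F` form a finite set — the conclusion of the
named fact `IwasawaTheory.classicalMuVanishes_finite_unramifiedClasses` — then the everywhere-unramified
continuous homomorphisms `Hom(res(ker κ_F), M; ∅)` (`unramifiedHoms`, vanishing on `I_𝔓 ∩ res(ker κ_F)`
for EVERY prime `𝔓` of `\bar ℤ_K`) form a finite set. The map is `f ↦ [f ∘ res]` (a homomorphism is a
cocycle for the trivial action, and distinct homomorphisms give distinct classes); the unramified
condition transports because `res (σ⁻¹ y σ) ∈ I_{ι⁻¹(σ⁻¹ 𝔓₀(w))}` for `y ∈ I_w = I_{𝔓₀(w)}`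
(Neukirch II (9.6)). [cite: CoatesSujatha2005, §3 (proof of Thm. 3.4: over `F_∞(E[p])` the fine classes are everywhere-unramified homomorphisms)]
[cite: NeukirchANT1999, Ch. II §9 Prop. (9.6); Ch. I §9 Prop. (9.1)] -/
theorem finite_unramifiedHoms_map_of_finite_unramifiedClasses
    [DistribMulAction (absoluteGaloisGroup F) M]
    (htriv : ∀ (σ : absoluteGaloisGroup F) (m : M), σ • m = m) (κF : ZpExtension F p)
    (hfin : {c : subgroupH1 κF.kerSubgroup M |
      ∀ (w : HeightOneSpectrum (𝓞 F)) (σ : absoluteGaloisGroup F),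
        conjH1 κF.kerSubgroup M σ c ∈ GreenbergVatsal2000.unramifiedKer κF.kerSubgroup M w}.Finite) :
    (unramifiedHoms (κF.kerSubgroup.map (absGaloisRestrict K F).toMonoidHom) M
      (∅ : Set (HeightOneSpectrum (𝓞 K)))).Finite := by
  set res := absGaloisRestrict K F with hres
  set H := κF.kerSubgroup with hH
  set U : Subgroup (absoluteGaloisGroup K) := H.map res.toMonoidHom with hU
  have htrivH : ∀ (g : H) (m : M), g • m = m := fun g m ↦ htriv (g : absoluteGaloisGroup F) m
  have hmemU : ∀ τ : H, res (τ : absoluteGaloisGroup F) ∈ U :=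
    fun τ ↦ Subgroup.mem_map.2 ⟨τ, τ.2, rfl⟩
  -- pull a function on `U` back to `H`
  let g : (U → M) → H → M := fun f τ ↦ f ⟨res (τ : absoluteGaloisGroup F), hmemU τ⟩
  have gadd : ∀ f ∈ unramifiedHoms U M (∅ : Set (HeightOneSpectrum (𝓞 K))),
      ∀ a b : H, g f (a * b) = g f a + g f b := by
    intro f hf a b
    have hab : (⟨res ((a * b : H) : absoluteGaloisGroup F), hmemU (a * b)⟩ : U) =
        ⟨res (a : absoluteGaloisGroup F), hmemU a⟩ * ⟨res (b : absoluteGaloisGroup F), hmemU b⟩ :=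
      Subtype.ext (by
        change res ((a * b : H) : absoluteGaloisGroup F) = res a * res b
        rw [Subgroup.coe_mul, map_mul])
    show f _ = f _ + f _
    rw [hab]
    exact hf.2.1 _ _
  have gcont : ∀ f ∈ unramifiedHoms U M (∅ : Set (HeightOneSpectrum (𝓞 K))), Continuous (g f) := by
    intro f hf
    exact hf.1.comp ((res.continuous.comp continuous_subtype_val).subtype_mk _)
  -- the everywhere-unramified condition, transported
  have hvan : ∀ f ∈ unramifiedHoms U M (∅ : Set (HeightOneSpectrum (𝓞 K))),
      ∀ (w : HeightOneSpectrum (𝓞 F)) (σ : absoluteGaloisGroup F) (y : inertiaIn H w),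
        g f (subgroupConj H σ (inertiaInToH H w y)) = 0 := by
    intro f hf w σ y
    obtain ⟨-, hyI⟩ := (mem_inertiaIn_iff H w (y : decomp w)).1 y.2
    have e : GreenbergSelmer.inertia w =
        (adicCompletionPrime F w).inertia (absoluteGaloisGroup F) :=
      (inertia_adicCompletionPrime_eq_map_absInertia F w).symm
    rw [e] at hyI
    set 𝔔 : Ideal (absIntegers (𝓞 F) F) := adicCompletionPrime F w with h𝔔
    have h1 : σ⁻¹ * ((y : decomp w) : absoluteGaloisGroup F) * σ ∈
        (σ⁻¹ • 𝔔).inertia (absoluteGaloisGroup F) := conj_mem_inertia_inv_smul 𝔔 hyI σ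
    have h2 := absGaloisRestrict_mem_inertia_comap K F h1
    haveI : (σ⁻¹ • 𝔔).IsMaximal := HeightOneSpectrum.isMaximal_of_mem_primesAbove
      (smul_mem_primesAbove (adicCompletionPrime_mem_primesAbove F w) σ⁻¹)
    haveI : ((σ⁻¹ • 𝔔).comap (absIntegersMap K F)).IsMaximal :=
      Ideal.comap_isMaximal_of_surjective _ (absIntegersMap_surjective K F)
    obtain ⟨v, hv⟩ :=
      FineSelmerTrivialisingRestriction.exists_mem_primesAbove_of_isMaximal
        ((σ⁻¹ • 𝔔).comap (absIntegersMap K F))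
    exact hf.2.2 v (Set.notMem_empty v) _ hv ⟨_, hmemU _⟩ h2
  -- the map `f ↦ [f ∘ res]`
  let Φ : (U → M) → subgroupH1 H M := fun f ↦
    if hf : f ∈ unramifiedHoms U M (∅ : Set (HeightOneSpectrum (𝓞 K))) then
      oneCocycleClass (discreteTopRep H M) (homCocycle htrivH (g f) (gadd f hf) (gcont f hf))
    else 0
  have hΦ : ∀ f (hf : f ∈ unramifiedHoms U M (∅ : Set (HeightOneSpectrum (𝓞 K)))),
      Φ f = oneCocycleClass (discreteTopRep H M)
        (homCocycle htrivH (g f) (gadd f hf) (gcont f hf)) := fun f hf ↦ dif_pos hf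
  refine Set.Finite.of_finite_image (f := Φ) (hfin.subset ?_) ?_
  · rintro _ ⟨f, hf, rfl⟩
    show Φ f ∈ _
    rw [hΦ f hf]
    intro w σ
    rw [conjH1_oneCocycleClass_mem_unramifiedKer_iff]
    refine ⟨0, fun y ↦ ?_⟩
    rw [smul_zero, sub_zero, homCocycle_apply, hvan f hf w σ y, smul_zero]
  · intro f₁ hf₁ f₂ hf₂ heq
    have heq' : Φ f₁ = Φ f₂ := heq
    rw [hΦ f₁ hf₁, hΦ f₂ hf₂, oneCocycleClass_eq_iff_of_trivial htrivH] at heq'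
    funext u
    obtain ⟨τ, hτ, hτu⟩ := Subgroup.mem_map.1 u.2
    have hu : u = ⟨res τ, hmemU ⟨τ, hτ⟩⟩ := Subtype.ext hτu.symm
    have h := congrArg (fun z : contOneCocycles (discreteTopRep H M) ↦ z.1 ⟨τ, hτ⟩) heq'
    rw [hu]
    exact h

end Bridge

/-! ## §2 Kernels and ranges along the restriction -/

section Kernels

variable {K : Type} [Field K] [NumberField K] {F : Type} [Field F] [Algebra K F]
variable {p : ℕ} [Fact p.Prime]

/-- **Cyclotomic kernels match along any extension**: if `κ` is the cyclotomic `ℤ_p`-extension of `K`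
and `κ_F` the cyclotomic `ℤ_p`-extension of `F ⊇ K`, then `ker κ_F = res⁻¹(ker κ)`
(`F_∞^{cyc} = F·K_∞^{cyc}`), because both kernels are `χ_p⁻¹(μ(ℤ_p))` and `χ_{p,K} ∘ res = χ_{p,F}`.
No degree hypothesis (the tree's `IsCyclotomic.kerSubgroup_eq_comap_of_not_dvd_finrank` assumed
`p ∤ [F : K]`). [cite: Washington1997, §13.1] [cite: GreenbergLNM1716, §1] -/
theorem kerSubgroup_eq_comap_of_isCyclotomic (κ : ZpExtension K p) (hκ : κ.IsCyclotomic)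
    (κF : ZpExtension F p) (hκF : κF.IsCyclotomic) :
    κF.kerSubgroup = κ.kerSubgroup.comap (absGaloisRestrict K F).toMonoidHom := by
  haveI : NeZero (p : K) := ⟨Nat.cast_ne_zero.mpr (Fact.out : p.Prime).ne_zero⟩
  unfold ZpExtension.IsCyclotomic at hκ hκF
  rw [hκF, hκ, Subgroup.comap_comap]
  congr 1
  exact MonoidHom.ext fun σ ↦ (cyclotomicCharacter_absGaloisRestrict K F p σ).symm

omit [NumberField K] in
/-- **`res(Γ_E) = Gal(K̄/E)` for a normal intermediate field `E ⊆ K̄`.** The range of the restriction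
`absGaloisRestrict K E : Γ_E → Γ_K` is the fixing subgroup of `E` (in general it is the fixing
subgroup of a conjugate embedding `e(E)`, `exists_mem_range_absGaloisRestrict_iff`; for `E/K` normal
`e(E) = E`, Mathlib `AlgHom.fieldRange_of_normal`). [cite: MilneFT2022, Ch. 7 (restriction to a subfield)]
[cite: NeukirchANT1999, Ch. IV §1] -/
theorem range_absGaloisRestrict_eq_fixingSubgroup (E : IntermediateField K (AlgebraicClosure K))
    [Normal K E] :
    (absGaloisRestrict K E).range = (E.fixingSubgroup : Subgroup (absoluteGaloisGroup K)) := by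
  obtain ⟨e, he⟩ := exists_mem_range_absGaloisRestrict_iff K E
  have hfr : e.fieldRange = E := AlgHom.fieldRange_of_normal e
  ext g
  rw [he]
  constructor
  · intro h
    refine (IntermediateField.mem_fixingSubgroup_iff E (absoluteGaloisGroup.toAlgEquiv K g)).2
      fun x hx ↦ ?_
    have hx' : x ∈ e.fieldRange := by rw [hfr]; exact hx
    obtain ⟨y, rfl⟩ := AlgHom.mem_fieldRange.1 hx'
    have := h y
    rwa [absoluteGaloisGroup.smul_def] at this
  · intro h y
    have hy : (e y : AlgebraicClosure K) ∈ E := by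
      have h' : e y ∈ e.fieldRange := AlgHom.mem_fieldRange.2 ⟨y, rfl⟩
      rw [hfr] at h'
      exact h'
    rw [absoluteGaloisGroup.smul_def]
    exact (IntermediateField.mem_fixingSubgroup_iff E (absoluteGaloisGroup.toAlgEquiv K g)).1 h _ hy

omit [NumberField K] in
/-- If `res(Γ_F) = N` and `ker κ_F = res⁻¹(ker κ)`, then `res(ker κ_F) = N ⊓ ker κ`
(`Gal(K̄/F·K_∞) = Gal(K̄/F) ∩ Gal(K̄/K_∞)`). [cite: Washington1997, §13.1] -/
theorem map_kerSubgroup_eq_inf (κ : ZpExtension K p) (κF : ZpExtension F p)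
    {N : Subgroup (absoluteGaloisGroup K)} (hrange : (absGaloisRestrict K F).range = N)
    (hker : κF.kerSubgroup = κ.kerSubgroup.comap (absGaloisRestrict K F).toMonoidHom) :
    κF.kerSubgroup.map (absGaloisRestrict K F).toMonoidHom = N ⊓ κ.kerSubgroup := by
  rw [hker, Subgroup.map_comap_eq, ← hrange]

end Kernels

/-! ## §3 `Sel₀(K_∞, M)` finite from the classical `μ = 0` of `K(M)` -/

section Assembly

variable {K : Type} [Field K] [NumberField K] {p : ℕ} [Fact p.Prime]

/-- **`Sel₀(K_∞, M)` is finite when the classical `μ`-invariant of the trivialising field vanishes**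
(Coates–Sujatha's argument, modulo the character form of Iwasawa's `μ = 0`). Data: `κ` a
`ℤ_p`-extension of the number field `K`, `p` odd; `M` a finite discrete `p`-primary `Γ_K`-module with
continuous action; `F/K` with `res(Γ_F) = fixingSubgroupOfModule K M` (i.e. `F ≅ K(M)`), `κ_F` a
`ℤ_p`-extension of `F` with `ker κ_F = res⁻¹(ker κ)` (`F_∞ = F·K_∞`). If
`classicalMuVanishes_finite_unramifiedClasses` (named fact) and `ClassicalMuVanishes κ_F`, then
`Sel₀(K_∞, M)` is finite: the named fact gives finitely many everywhere-unramified classes of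
`Gal(F̄/F_∞)` with values in the trivial module `M`; §1 transports them to `Hom(N ∩ H, M; ∅)`; k8t-c4
g21's `finite_fineSelmerInfty_of_finite_unramifiedHoms` (inflation–restriction) concludes.
[cite: CoatesSujatha2005, Thm. 3.4 (proof)] [cite: Lang1990, Ch. 5 §1 Thm. 1.2, §4 Thm. 4.4] -/
theorem finite_fineSelmerInfty_of_classicalMuVanishes
    (hchar : classicalMuVanishes_finite_unramifiedClasses) (hp : Odd p) (κ : ZpExtension K p)
    (M : Type) [AddCommGroup M] [DistribMulAction (absoluteGaloisGroup K) M] [TopologicalSpace M]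
    [DiscreteTopology M] [Finite M] [ContinuousSMul (absoluteGaloisGroup K) M]
    (hM : ∃ k : ℕ, Nat.card M = p ^ k)
    (F : Type) [Field F] [NumberField F] [Algebra K F] [Algebra.IsAlgebraic K F]
    (hrange : (absGaloisRestrict K F).range = fixingSubgroupOfModule K M)
    (κF : ZpExtension F p)
    (hker : κF.kerSubgroup = κ.kerSubgroup.comap (absGaloisRestrict K F).toMonoidHom)
    (hμ : ClassicalMuVanishes κF) :
    (fineSelmerInfty M κ : Set (subgroupH1 κ.kerSubgroup M)).Finite := by
  letI instF : DistribMulAction (absoluteGaloisGroup F) M :=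
    DistribMulAction.compHom M (absGaloisRestrict K F).toMonoidHom
  have htriv : ∀ (σ : absoluteGaloisGroup F) (m : M), σ • m = m := fun σ m ↦ by
    have hσ : absGaloisRestrict K F σ ∈ fixingSubgroupOfModule K M := hrange ▸ ⟨σ, rfl⟩
    exact smul_eq_of_mem_fixingSubgroupOfModule hσ m
  have hfinF := hchar F p κF (Or.inl hp) hμ M hM htriv
  have hU := finite_unramifiedHoms_map_of_finite_unramifiedClasses (K := K) htriv κF hfinF
  rw [map_kerSubgroup_eq_inf κ κF hrange hker] at hU
  exact finite_fineSelmerInfty_of_finite_unramifiedHoms κ hU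

end Assembly

/-! ## §4 `M = E[p]`, `F = K(E[p])`: Coates–Sujatha's Thm. 3.4 from the character form of `μ = 0` -/

section EllipticCurve

variable {K : Type} [Field K] [NumberField K]

/-- `res(Γ_{K(E[n])}) = Γ_{K(E[n])}`: the range of the restriction from the absolute Galois group of the
`n`-division field (as an abstract field) is the kernel `fixingSubgroupOfModule K E[n]` of the action on
`E[n]` (`K(E[n])/K` is Galois). [cite: SilvermanAEC2009, VIII.§1] -/
theorem range_absGaloisRestrict_divisionField (W : WeierstrassCurve K) [W.IsElliptic] (n : ℕ)
    [NeZero n] :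
    (absGaloisRestrict K (W.divisionField n)).range =
      fixingSubgroupOfModule K (W.geomTorsion (n : ℤ)) := by
  rw [range_absGaloisRestrict_eq_fixingSubgroup, W.fixingSubgroup_divisionField n]

/-- **Statement (A) from the classical `μ = 0` of `K(E[p])`, over a number field** (Coates–Sujatha
2005 Thm. 3.4, modulo the character form of Iwasawa's `μ = 0`): for `E/K` elliptic, `p` odd, `κ` the
cyclotomic `ℤ_p`-extension of `K`: if `classicalMuVanishes_finite_unramifiedClasses` and
`ClassicalMuVanishes` holds for (every) cyclotomic `ℤ_p`-extension of `K(E[p])`, then the dual fine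
Selmer group of `E` over `K_∞` is finitely generated over `ℤ_p` (the tree's `∃ γ D` spelling;
`LimSujatha2018.fineSelmerDual_moduleFinite_iff_finite_fineSelmerInfty_torsion`). No hypothesis on
`K(E[p]) ∩ K_∞`. [cite: CoatesSujatha2005, Thm. 3.4] [cite: LimSujatha2018, §3 (lemma before Prop. 3.2)] -/
theorem fineSelmerDual_moduleFinite_of_classicalMuVanishes_divisionField
    (hchar : classicalMuVanishes_finite_unramifiedClasses)
    (W : WeierstrassCurve K) [W.IsElliptic] {p : ℕ} [Fact p.Prime] (hp : p ≠ 2)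
    (hμ : haveI : NeZero p := ⟨(Fact.out : p.Prime).ne_zero⟩
      ∀ κF : ZpExtension (W.divisionField p) p, κF.IsCyclotomic → ClassicalMuVanishes κF)
    (κ : ZpExtension K p) (hκ : κ.IsCyclotomic) :
    ∃ (γ : absoluteGaloisGroup K) (D : W.FineSelmerDualData κ γ),
      Module.Finite ℤ_[p] (RestrictScalars ℤ_[p] (IwasawaAlgebra p) D.X) := by
  haveI : NeZero p := ⟨(Fact.out : p.Prime).ne_zero⟩
  haveI : NumberField (W.divisionField p) := NumberField.of_module_finite K _
  have hodd : Odd p := (Fact.out : p.Prime).odd_of_ne_two hp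
  rw [LimSujatha2018.fineSelmerDual_moduleFinite_iff_finite_fineSelmerInfty_torsion W hp κ hκ]
  obtain ⟨κF, hκF⟩ := ZpExtension.exists_isCyclotomic_holds (W.divisionField p) p
    (GaloisRep.cyclotomicCharacter_range_infinite (W.divisionField p) p)
  haveI : Finite (W.geomTorsion (p : ℤ)) := W.finite_geomTorsion_nat (NeZero.ne p)
  haveI : ContinuousSMul (absoluteGaloisGroup K) (W.geomTorsion (p : ℤ)) :=
    W.continuousSMul_geomTorsion W.isOpen_stabilizer_point_holds p
  have hcard : ∃ k : ℕ, Nat.card (W.geomTorsion (p : ℤ)) = p ^ k :=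
    ⟨2, W.natCard_geomTorsion_eq_sq_of_charZero (Fact.out : p.Prime)⟩
  exact finite_fineSelmerInfty_of_classicalMuVanishes hchar hodd κ (W.geomTorsion (p : ℤ)) hcard
    (W.divisionField p) (range_absGaloisRestrict_divisionField W p) κF
    (kerSubgroup_eq_comap_of_isCyclotomic κ hκ κF hκF) (hμ κF hκF)

/-- **Coates–Sujatha 2005 Thm. 3.4 for `E/ℚ` (the named fact
`CoatesSujatha2005.thm34_fineSelmerDual_moduleFinite_of_classicalMuVanishes_divisionField`, the cell's
`hCS`) FOLLOWS from the character form of Iwasawa's `μ = 0`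
(`IwasawaTheory.classicalMuVanishes_finite_unramifiedClasses`).** [cite: CoatesSujatha2005, Thm. 3.4]
[cite: Lang1990, Ch. 5 §§1–4] -/
theorem thm34_of_classicalMuVanishes_finite_unramifiedClasses
    (hchar : classicalMuVanishes_finite_unramifiedClasses) :
    CoatesSujatha2005.thm34_fineSelmerDual_moduleFinite_of_classicalMuVanishes_divisionField := by
  intro W _ p _ hp hμ κ hκ
  exact fineSelmerDual_moduleFinite_of_classicalMuVanishes_divisionField hchar W hp hμ κ hκ

end EllipticCurve

end Literature.NumberTheory.EllipticCurves.FineSelmerFiniteOfUnramifiedClasses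

end
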